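import Mathlib
import HarnessLib
import Summits.HubbardSuperconductivity.HubbardSuperconductivity.Theorems.KLProgrammeKLRegimeEngineScaleZeroDecay

/-!
# Two threshold bridges of the K3 engine's stub binders: `klEngL₃ β U ≤ L ⇒ β² ≤ L` and `klEngM₃ β U L ≤ M ⇒ β ≤ M`

Cell `gate-hubbard-kl`, seat p3 g6.  The isotropic torus bound `IsoTorusBoundAt` (…EngineIsoTorusDefs) is stated under the binders of
`stub_engine_scale0`; p4 g7's proof of it ((J1)–(J3)) runs at the weaker cut-offs `β ^ 2 ≤ L`, `β ≤ M`.  These two one-liners bridge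
(`le_of_klEngL₃_le : β ≤ L` and `pow_three_le_of_klEng : β³ ≤ M` are already in the tree).
-/

namespace Summit.HubbardSuperconductivity.HubbardSuperconductivity.Theorems.EngineV8

noncomputable section

open Real Summit.HubbardSuperconductivity.HubbardSuperconductivity.Theorems.KLRegimeSplit
open Summit.HubbardSuperconductivity.HubbardSuperconductivity.Theorems.ScaleZeroDecay

/-- **`klEngL₃ β U ≤ L ⇒ β² ≤ L`** (`klEngL₃ = 2^{10}(⌈|β|⌉₊+1)²(⌈|U|⁻¹⌉₊+1)² ≥ (⌈|β|⌉₊+1)² ≥ β²`). -/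
theorem sq_le_of_klEngL₃_le {β U : ℝ} {L : ℕ} (h : klEngL₃ β U ≤ L) : β ^ 2 ≤ (L : ℝ) := by
  unfold klEngL₃ at h
  have h2 : |β| ≤ (⌈|β|⌉₊ : ℝ) := Nat.le_ceil _
  have h3 : ((2 ^ 10 * (⌈|β|⌉₊ + 1) ^ 2 * (⌈|U|⁻¹⌉₊ + 1) ^ 2 : ℕ) : ℝ) ≤ (L : ℝ) := by exact_mod_cast h
  push_cast at h3
  have h4 : (1 : ℝ) ≤ ((⌈|U|⁻¹⌉₊ : ℝ) + 1) ^ 2 := by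
    have : (0 : ℝ) ≤ ⌈|U|⁻¹⌉₊ := Nat.cast_nonneg _
    nlinarith
  have h0 : (0 : ℝ) ≤ ⌈|β|⌉₊ := Nat.cast_nonneg _
  have h5 : β ^ 2 ≤ ((⌈|β|⌉₊ : ℝ) + 1) ^ 2 := by
    rw [← sq_abs β]
    have hb : 0 ≤ |β| := abs_nonneg β
    nlinarith
  have h6 : ((⌈|β|⌉₊ : ℝ) + 1) ^ 2 ≤ 2 ^ 10 * ((⌈|β|⌉₊ : ℝ) + 1) ^ 2 * ((⌈|U|⁻¹⌉₊ : ℝ) + 1) ^ 2 := by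
    have hsq : 0 ≤ ((⌈|β|⌉₊ : ℝ) + 1) ^ 2 := sq_nonneg _
    nlinarith
  linarith

/-- **`klBetaMin ≤ β`, `klEngL₃ β U ≤ L`, `klEngM₃ β U L ≤ M ⇒ β ≤ M`** (from `β³ ≤ M` and `1 ≤ β`). -/
theorem le_of_klEngM₃_le {β U : ℝ} {L M : ℕ} (hβ : klBetaMin ≤ β) (hL : klEngL₃ β U ≤ L) (hM : klEngM₃ β U L ≤ M) :
    β ≤ (M : ℝ) := by
  have h3 := pow_three_le_of_klEng hβ hL hM
  have h1 : 1 ≤ β := le_trans (by norm_num [klBetaMin]) hβ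
  have h2 : 1 ≤ β ^ 2 := by nlinarith
  have : β ≤ β ^ 3 := by
    have : β ^ 3 = β * β ^ 2 := by ring
    rw [this]
    nlinarith
  linarith

end

end Summit.HubbardSuperconductivity.HubbardSuperconductivity.Theorems.EngineV8
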